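import Summits.QuantumFields.YangMills.Theorems.BalabanUVNodesN15KingModelCurvedKnitField
import Summits.QuantumFields.YangMills.Theorems.BalabanUVNodesN15SiteScalarLayerMasslessDerived
import HarnessLib

/-!
# Route «BalabanUVNodes», cluster K4 «SpineRates» — node N15 = NE2: THE SITE LAYER WITH THE BACKGROUND LIVE IN THE TwoGrid ENTRY CURRENCY, XXX — THE CURVED KNIT AT THE
# MASSLESS ENDPOINT: dag-n15-e's nine King letters on the CLOSED mass range `0 ≤ m² ≤ m₀²`, and dag-n15-w3's curved dressed pair of King's propagator `⊗ 1` — dressed by the GENUINE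
# adjoint transporters `e^{η′Z′(x)}` (`Z′ = ad A′`: `Ad(e^{η′A′(x)})`) of a small, slowly varying generator FIELD — with its two-grid η-defect majorant, now INCLUDING `m² = 0`: the
# inductive datum of the EXACT-TRANSPORTER edition of this seat's coloured site layer (parts XXI–XXIX dress the massless `G′ ⊗ 1` by the FIRST-ORDER `ad A′`-species only)

Cell `pub-ymgap`, WIDTH SEAT `pub-ymgap-dag-n15-w1` (generation 4; director-ym №197 ∕ HUMAN RULING D-0149; chair R455 (A) ∕ R461; dag-lead KEY MAP v2 INBOX l.35754; self-located sequel of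
this seat's g3 honest leftover «the site layer's dressing is the first-order species», bus CLAIM-1 = INTENT-1 l.37310).  `bears_on: R4∕N15 · K3⁸ SpineGivenEndpointR13SepCoPHV
(stmt-QuantumFields-27366; K3⁷ 20544 aside = lineage)`.  Filed `--kind proof --supports stmt-QuantumFields-27366 --as helper` — COUNT-NEUTRAL.  THEOREMS ONLY (0 `def`, 0 `sorry`).
Imports BY NAME dag-n15-w2's Ω-f `…N15KingModelCurvedKnitField` (through it dag-n15-e's Ω-b `…KingModelCurvedKnitObjects` — `kingFullProp_uniform_layer_backward`, `kingGT`, `kingGT₁`,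
`kingGOp₁`, `castT`, `covPieces_flat_*`, `idef_conj_eq` — and Ω-c `…KingModelCurvedKnitFlat`, dag-n15-w3's p595387 `hasMaj_idef_curvDressed_kingTorus`, dag-n15-w2's p595427
`coordMat_adCLM_transpose_eq_neg_of_conjTranspose`) and this seat's part VIII `…N15SiteScalarLayerMasslessDerived` (part VII §1 `hasMaj_ofBlocks_of_massLimit`, §2
`continuousAt_kingGOp_mass`, `continuousAt_idef_kingGOp_mass`; part VIII §1 `continuousAt_kingDOp_mass`, `continuousAt_idef_kingDOp_mass`); nothing in the tree is modified.

WHY.  This seat's parts XXI–XXIX typed the COLOURED site layer with the background live, but its dressing of the massless coloured site propagator `G′ ⊗ 1_ι` (part XXIII; = dag-n15-e's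
`kingGT L a 0 K M ι`) is the FIRST-ORDER species `ad A′` of [Balaban1985BackgroundPropagators] (3.52) — the linearisation of the adjoint transporter `R(U′_b) = Ad(e^{η′A′(b)})`.
dag-n15-w3's curved dressed pair `curvDressed` ((3.53) in transporter form, no truncation) with `S = expTrField e η′ (ad ∘ A′) = coordMat e (Ad(e^{η′A′}))` (dag-n15-w2 p596957
`exp(η ad_a) = Ad_{exp(ηa)}`) dresses by the EXACT transporter, all orders in `A′`; its two-grid η-defect on King's one-step torus pairing is dag-n15-e's Ω-c (constant generator) and
dag-n15-w2's Ω-f (generator FIELD, letters on the potential) — both typed for masses `0 < m² ≤ m₀²`, King's model being massive.  The site layer of record is MASSLESS ([Balaban1984PropagatorsI]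
p. 25: `G′ = (Δ + aQ′*Q′)⁻¹`, no mass; this seat's part VII).  THIS FILE takes the endpoint: the nine scalar letters of the inductive datum hold on the CLOSED range `[0, m₀²]` (Ω-b on
`(0, m₀² + 1]`, each of the nine operators continuous in `m²` at `0` entrywise, a block majorant between sharp block sizes being a closed condition — part VII §1), and Ω-f's knit, which
reads only those nine letters, re-runs verbatim at every `0 ≤ m² ≤ m₀²`.  Sequels (separate files): the curved dressed pair's SIZED letters (sizes, increments, defect) in part XXII's
currency, then part XXI's socket ⇒ `NE2PlusSite` for every colour entry of the curved-dressed coloured site kernel.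

CONTENTS.
* §1 ★ `kingFullProp_layer_backward_massRange` — Ω-b's NINE scalar letters (`G`, `D⁺_μ`, `D⁻_μ = S_{−μ}D⁺_μ` on both grids, the three η-defects through King's pairing `underPtN`) at
  ONE `(β, δ, m)` for EVERY `K ≥ 1`, `n ≥ 1`, cube `2L^e`, size datum, direction and EVERY mass `0 ≤ m² ≤ m₀²` ([folklore] endpoint bookkeeping).
* §2 ★★ `hasMaj_idef_curvDressed_kingTorus_king_field_massRange` — Ω-f §1's conclusion VERBATIM on `0 ≤ m² ≤ m₀²` (proof = Ω-c∕Ω-f's reading of the nine letters through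
  `tensorId`∕`castT`∕`covPieces_flat_*`, fed §1 — adapted from `…KingModelCurvedKnitField` §1 ∕ `…KingModelCurvedKnitFlat`, credited).
* §3 ★★ `uN_hasMaj_idef_curvDressed_kingTorus_king_field_massRange` — Ω-f §2's `𝔲(N)` edition (`𝔄 = M_N(ℂ)`, `Z′ = ad ∘ A′`, `(A′)ᴴ = −A′`, letters ON THE POTENTIAL `a₀, g_A, G_A`) on
  `0 ≤ m² ≤ m₀²`; `…_massless` = the `m² = 0` member (the site layer's).

HONEST FRAMING ∕ LIMITS.  Count-neutral; [folklore] continuity∕closure bookkeeping + a re-run of a LANDED knit on the closed mass range; no new analytic estimate.  King's `A = 0` MODEL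
propagator at the FLAT base point (`W′ = 0`) dressed by the exact adjoint transporter of a small generator field (coarse generator = block mean — the lineage's model of the averaging,
not Bałaban's (3.8)); ONE blocking step; NOT Bałaban's `G(U)` at a (3.35)-regular `U` of the datum, NOT a curved base point, NOT the (C3) transport; nothing of [B5]∕[B6]∕[B9] asserted
((3.35)–(3.37) p. 396, (3.50)–(3.53) p. 400, Thm 3.1 (3.42) p. 397, (3.63)–(3.65) pp. 402–403 = SHAPES ∕ MECHANISM; [King1986] (2.13)–(2.17) p. 653, (4.1)–(4.5) p. 670 = TEMPLATE).  NE2⁺ NOT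
PRINTED ∕ NOT proved for d = 4; **N15 is NOT discharged**; K3⁸ OPEN, not claimed, skeleton v6 untouched; counts of record UNMOVED (typed 28∕28 · discharged 5∕27, A 5∕28); no summit
statement is proved here; one finite four-torus programme at fixed `ε` — NOT ℝ⁴, NOT infinite volume, NOT OS, NOT a mass gap, NOT Clay; R4 closes the conditional finite-𝕋⁴ rung
`BalabanLadder.UV` only.  Restate-immune (no Theses import).
-/

set_option autoImplicit false

noncomputable section
open scoped BigOperators Matrix Matrix.Norms.Frobenius Topology

namespace Summit.QuantumFields.YangMills.BalabanUVNodes.N15.SiteLayerBg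

open Real Finset NormedSpace Filter
open Literature.MathematicalPhysics.QuantumFieldTheory.Balaban1983to89
open Literature.MathematicalPhysics.QuantumFieldTheory.Balaban1983to89.B11SectG (BlockNorm HasMaj RowSum)
open Literature.MathematicalPhysics.QuantumFieldTheory.Balaban1983to89.B6RandomWalk (Triangle254)
open Literature.MathematicalPhysics.QuantumFieldTheory.Balaban1983to89.B6UnitTorusCarrier (unitTorusGeo triangle254_unitTorusGeo rowSum_unitTorusGeo)
open Literature.MathematicalPhysics.QuantumFieldTheory.Balaban1983to89.T4EtaRateDefect (idef idef_apply idef_comp)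
open Literature.MathematicalPhysics.QuantumFieldTheory.Balaban1983to89.T4EtaRateCoeffDefect (pull pull_apply)
open Literature.MathematicalPhysics.QuantumFieldTheory.Balaban1983to89.B5Prop11Plancherel (Tor fine unitVec)
open Literature.MathematicalPhysics.QuantumFieldTheory.King1986 (aK aK_pos)
open Literature.MathematicalPhysics.QuantumFieldTheory.King1986.Torus (fineOp blockOf tdistT tdistT_nonneg)
open Literature.MathematicalPhysics.QuantumFieldTheory.Balaban1983to89.Beta.AveragingCorrectionJets (adCLM norm_adCLM_le adCLM_smul)
open Literature.Barriers.QuantumFields (traceForm)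
open Summit.QuantumFields.YangMills.BalabanUVNodes.N15.VectorPiece (unitTorusGeoS tensorId tensorId_apply hasMaj_tensorId idef_tensorId)
open Summit.QuantumFields.YangMills.BalabanUVNodes.N15.MatrixSpecies (liftMap liftBlk liftEquiv liftEquiv_apply liftEquiv_symm_apply coordMat coordMat_sub basisConst
  basisConst_nonneg Phi0 adCLM_sub)
open Summit.QuantumFields.YangMills.BalabanUVNodes.N15.BackgroundLayer (fgrad bgrad liftPair blkPair coordMat_smul coordMat_one)
open Summit.QuantumFields.YangMills.BalabanUVNodes.N15.CurvedSpecies (torStep blockMeanField blockMeanTV covPieces covPieces_one gaugePair gaugePair_one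
  curvDressed expTrField expTrField_apply expRowLetter expFitLetter torStep_symm_apply hasMaj_idef_curvDressed_kingTorus coordMat_adCLM_transpose_eq_neg_of_conjTranspose)
open Summit.QuantumFields.YangMills.BalabanUVNodes.N15KingModelRung.Curved

variable {d : ℕ} (L : ℕ)

/-! ## §1 ★ The nine King letters on the closed mass range `0 ≤ m² ≤ m₀²` -/

section Letters

variable [NeZero L]

/-- ★ **dag-n15-e's NINE SCALAR LETTERS ON THE CLOSED MASS RANGE.**  For odd `L ≥ 3`, `a > 0`, `m₀² ≥ 0`, `0 ≤ γ < 1`, `0 < α < 1` there are `β, δ, m > 0` such that for every `K ≥ 1`,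
`n ≥ 1`, cube `2L^e`, mass `0 ≤ m² ≤ m₀²` (the endpoint INCLUDED), size datum `Msz` and direction `μ`: the six PLAIN block majorants `β·e^{−δ|y−y′|_T}` of King's full `A = 0`
propagator `G`, its derived piece `D⁺_μ = N∇_μG` and the backward piece `D⁻_μ = S_{−μ}D⁺_μ` (coarse run on `Tor (fine (L^K) M)`, fine run on `Tor (fine (L^nL^K) M)`), and the three
η-DEFECT majorants `m·((L^K)^{−γ∕2} + (L^K)^{−α})·e^{−δ|y−y′|_T}` of `(G′, G)`, `(D′⁺_μ, D⁺_μ)`, `(D′⁻_μ, D⁻_μ)` through King's pairing `underPtN` — Ω-b's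
`kingFullProp_uniform_layer_backward` on `(0, m₀² + 1]`, and at `m² = 0` its limit: every one of the nine operators is continuous in `m²` at `0` entrywise (parts VII §2 ∕ VIII §1:
the massless `A₀(a_K, N², 0)` is invertible and the matrix inverse is continuous there), and a block majorant between sharp block sup sizes is a closed condition (part VII §1
`hasMaj_ofBlocks_of_massLimit`). [cite: King1986, (2.13)–(2.17) p.653, (4.1)–(4.5) p.670, p.664 (pairing); Balaban1984PropagatorsI, p.25 («its inverse is a bounded operator G′», massless); Balaban1985BackgroundPropagators, Thm 3.1 (3.42)–(3.43) pp.397–398 (shapes)] -/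
theorem kingFullProp_layer_backward_massRange (hLodd : Odd L) (hL : 2 ≤ L) {a : ℝ} (ha : 0 < a) {m0sq : ℝ} (hm0 : 0 ≤ m0sq) {γ : ℝ} (hγ0 : 0 ≤ γ)
    (hγ1 : γ < 1) {α : ℝ} (hα0 : 0 < α) (hα1 : α < 1) :
    ∃ β δ m : ℝ, 0 < β ∧ 0 < δ ∧ 0 < m ∧ ∀ (K : ℕ), 1 ≤ K → ∀ (n : ℕ), 1 ≤ n → ∀ (e : ℕ) (M : Fin (d + 1) → ℕ) [∀ μ, NeZero (M μ)],
      (∀ μ, M μ = 2 * L ^ e) → ∀ (msq : ℝ), 0 ≤ msq → msq ≤ m0sq → ∀ (Msz : ℝ) (μ : Fin (d + 1)),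
      -- plain, coarse run: `G`, `D⁺_μ`, `D⁻_μ`
      HasMaj (BlockNorm.ofBlocks (unitTorusGeoS L K M Msz) (blockOf (L ^ K) M)) (BlockNorm.ofBlocks (unitTorusGeoS L K M Msz) (blockOf (L ^ K) M))
          (kingGOp L a msq K (L ^ K) M) (fun y y' => β * Real.exp (-(δ * tdistT M y y')))
      ∧ HasMaj (BlockNorm.ofBlocks (unitTorusGeoS L K M Msz) (blockOf (L ^ K) M)) (BlockNorm.ofBlocks (unitTorusGeoS L K M Msz) (blockOf (L ^ K) M))
          (kingDOp L a msq K (L ^ K) M μ) (fun y y' => β * Real.exp (-(δ * tdistT M y y')))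
      ∧ HasMaj (BlockNorm.ofBlocks (unitTorusGeoS L K M Msz) (blockOf (L ^ K) M)) (BlockNorm.ofBlocks (unitTorusGeoS L K M Msz) (blockOf (L ^ K) M))
          (pull ⇑(Equiv.addRight (unitVec (fine (L ^ K) M) μ)).symm ∘ₗ kingDOp L a msq K (L ^ K) M μ) (fun y y' => β * Real.exp (-(δ * tdistT M y y')))
      -- plain, fine run: `G′`, `D′⁺_μ`, `D′⁻_μ`
      ∧ HasMaj (BlockNorm.ofBlocks (unitTorusGeoS L K M Msz) (blockOf (L ^ K) M ∘ underPtN L K n M))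
          (BlockNorm.ofBlocks (unitTorusGeoS L K M Msz) (blockOf (L ^ K) M ∘ underPtN L K n M))
          (kingGOp L a msq (K + n) (L ^ n * L ^ K) M) (fun y y' => β * Real.exp (-(δ * tdistT M y y')))
      ∧ HasMaj (BlockNorm.ofBlocks (unitTorusGeoS L K M Msz) (blockOf (L ^ K) M ∘ underPtN L K n M))
          (BlockNorm.ofBlocks (unitTorusGeoS L K M Msz) (blockOf (L ^ K) M ∘ underPtN L K n M))
          (kingDOp L a msq (K + n) (L ^ n * L ^ K) M μ) (fun y y' => β * Real.exp (-(δ * tdistT M y y')))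
      ∧ HasMaj (BlockNorm.ofBlocks (unitTorusGeoS L K M Msz) (blockOf (L ^ K) M ∘ underPtN L K n M))
          (BlockNorm.ofBlocks (unitTorusGeoS L K M Msz) (blockOf (L ^ K) M ∘ underPtN L K n M))
          (pull ⇑(Equiv.addRight (unitVec (fine (L ^ n * L ^ K) M) μ)).symm ∘ₗ kingDOp L a msq (K + n) (L ^ n * L ^ K) M μ)
          (fun y y' => β * Real.exp (-(δ * tdistT M y y')))
      -- the three two-grid defects
      ∧ HasMaj (BlockNorm.ofBlocks (unitTorusGeoS L K M Msz) (blockOf (L ^ K) M))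
          (BlockNorm.ofBlocks (unitTorusGeoS L K M Msz) (blockOf (L ^ K) M ∘ underPtN L K n M))
          (idef (pull (underPtN L K n M)) (pull (underPtN L K n M)) (kingGOp L a msq (K + n) (L ^ n * L ^ K) M) (kingGOp L a msq K (L ^ K) M))
          (fun y y' => m * (((L : ℝ) ^ K) ^ (-(γ / 2)) + ((L : ℝ) ^ K) ^ (-α)) * Real.exp (-(δ * tdistT M y y')))
      ∧ HasMaj (BlockNorm.ofBlocks (unitTorusGeoS L K M Msz) (blockOf (L ^ K) M))
          (BlockNorm.ofBlocks (unitTorusGeoS L K M Msz) (blockOf (L ^ K) M ∘ underPtN L K n M))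
          (idef (pull (underPtN L K n M)) (pull (underPtN L K n M)) (kingDOp L a msq (K + n) (L ^ n * L ^ K) M μ) (kingDOp L a msq K (L ^ K) M μ))
          (fun y y' => m * (((L : ℝ) ^ K) ^ (-(γ / 2)) + ((L : ℝ) ^ K) ^ (-α)) * Real.exp (-(δ * tdistT M y y')))
      ∧ HasMaj (BlockNorm.ofBlocks (unitTorusGeoS L K M Msz) (blockOf (L ^ K) M))
          (BlockNorm.ofBlocks (unitTorusGeoS L K M Msz) (blockOf (L ^ K) M ∘ underPtN L K n M))
          (idef (pull (underPtN L K n M)) (pull (underPtN L K n M))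
            (pull ⇑(Equiv.addRight (unitVec (fine (L ^ n * L ^ K) M) μ)).symm ∘ₗ kingDOp L a msq (K + n) (L ^ n * L ^ K) M μ)
            (pull ⇑(Equiv.addRight (unitVec (fine (L ^ K) M) μ)).symm ∘ₗ kingDOp L a msq K (L ^ K) M μ))
          (fun y y' => m * (((L : ℝ) ^ K) ^ (-(γ / 2)) + ((L : ℝ) ^ K) ^ (-α)) * Real.exp (-(δ * tdistT M y y'))) := by
  obtain ⟨β, δ, m, hβ, hδ, hm, H⟩ := kingFullProp_uniform_layer_backward (d := d) L hLodd hL ha (show (0 : ℝ) ≤ m0sq + 1 by linarith) hγ0 hγ1 hα0 hα1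
  refine ⟨β, δ, m, hβ, hδ, hm, fun K hK n hn e M _ hM msq hmsq hcap Msz μ => ?_⟩
  -- positive masses: Ω-b directly (on the larger range `(0, m₀² + 1]`)
  rcases hmsq.lt_or_eq with hpos | h0
  · exact H K hK n hn e M hM msq hpos (by linarith) Msz μ
  -- the endpoint `m² = 0`: the nine letters on `(0, m₀² + 1]` pass to the limit, operator by operator
  subst h0
  have hL1 : 1 < L := by omega
  have hm1 : (0 : ℝ) < m0sq + 1 := by linarith
  have HK := fun (m2 : ℝ) (hm2 : 0 < m2) (hcap2 : m2 ≤ m0sq + 1) => H K hK n hn e M hM m2 hm2 hcap2 Msz μ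
  have hKn : 1 ≤ K + n := hK.trans (Nat.le_add_right K n)
  refine ⟨?_, ?_, ?_, ?_, ?_, ?_, ?_, ?_, ?_⟩
  · exact hasMaj_ofBlocks_of_massLimit (g := unitTorusGeoS L K M Msz) (blockOf (L ^ K) M) (blockOf (L ^ K) M) (fun m2 => kingGOp L a m2 K (L ^ K) M) _ hm1
      (fun lam x => continuousAt_kingGOp_mass M (L ^ K) L hL1 ha hK lam x) (fun m2 hm2 hcap2 => (HK m2 hm2 hcap2).1)
  · exact hasMaj_ofBlocks_of_massLimit (g := unitTorusGeoS L K M Msz) (blockOf (L ^ K) M) (blockOf (L ^ K) M) (fun m2 => kingDOp L a m2 K (L ^ K) M μ) _ hm1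
      (fun lam x => continuousAt_kingDOp_mass M (L ^ K) L hL1 ha hK μ lam x) (fun m2 hm2 hcap2 => (HK m2 hm2 hcap2).2.1)
  · refine hasMaj_ofBlocks_of_massLimit (g := unitTorusGeoS L K M Msz) (blockOf (L ^ K) M) (blockOf (L ^ K) M)
      (fun m2 => pull ⇑(Equiv.addRight (unitVec (fine (L ^ K) M) μ)).symm ∘ₗ kingDOp L a m2 K (L ^ K) M μ) _ hm1 (fun lam x => ?_) (fun m2 hm2 hcap2 => (HK m2 hm2 hcap2).2.2.1)
    simp only [LinearMap.comp_apply, pull_apply]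
    exact continuousAt_kingDOp_mass M (L ^ K) L hL1 ha hK μ lam _
  · exact hasMaj_ofBlocks_of_massLimit (g := unitTorusGeoS L K M Msz) (blockOf (L ^ K) M ∘ underPtN L K n M) (blockOf (L ^ K) M ∘ underPtN L K n M)
      (fun m2 => kingGOp L a m2 (K + n) (L ^ n * L ^ K) M) _ hm1
      (fun lam x => continuousAt_kingGOp_mass M (L ^ n * L ^ K) L hL1 ha hKn lam x) (fun m2 hm2 hcap2 => (HK m2 hm2 hcap2).2.2.2.1)
  · exact hasMaj_ofBlocks_of_massLimit (g := unitTorusGeoS L K M Msz) (blockOf (L ^ K) M ∘ underPtN L K n M) (blockOf (L ^ K) M ∘ underPtN L K n M)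
      (fun m2 => kingDOp L a m2 (K + n) (L ^ n * L ^ K) M μ) _ hm1
      (fun lam x => continuousAt_kingDOp_mass M (L ^ n * L ^ K) L hL1 ha hKn μ lam x) (fun m2 hm2 hcap2 => (HK m2 hm2 hcap2).2.2.2.2.1)
  · refine hasMaj_ofBlocks_of_massLimit (g := unitTorusGeoS L K M Msz) (blockOf (L ^ K) M ∘ underPtN L K n M) (blockOf (L ^ K) M ∘ underPtN L K n M)
      (fun m2 => pull ⇑(Equiv.addRight (unitVec (fine (L ^ n * L ^ K) M) μ)).symm ∘ₗ kingDOp L a m2 (K + n) (L ^ n * L ^ K) M μ) _ hm1 (fun lam x => ?_)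
      (fun m2 hm2 hcap2 => (HK m2 hm2 hcap2).2.2.2.2.2.1)
    simp only [LinearMap.comp_apply, pull_apply]
    exact continuousAt_kingDOp_mass M (L ^ n * L ^ K) L hL1 ha hKn μ lam _
  · exact hasMaj_ofBlocks_of_massLimit (g := unitTorusGeoS L K M Msz) (blockOf (L ^ K) M) (blockOf (L ^ K) M ∘ underPtN L K n M)
      (fun m2 => idef (pull (underPtN L K n M)) (pull (underPtN L K n M)) (kingGOp L a m2 (K + n) (L ^ n * L ^ K) M) (kingGOp L a m2 K (L ^ K) M)) _ hm1
      (fun lam x' => continuousAt_idef_kingGOp_mass M L hL1 ha hK n lam x') (fun m2 hm2 hcap2 => (HK m2 hm2 hcap2).2.2.2.2.2.2.1)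
  · exact hasMaj_ofBlocks_of_massLimit (g := unitTorusGeoS L K M Msz) (blockOf (L ^ K) M) (blockOf (L ^ K) M ∘ underPtN L K n M)
      (fun m2 => idef (pull (underPtN L K n M)) (pull (underPtN L K n M)) (kingDOp L a m2 (K + n) (L ^ n * L ^ K) M μ) (kingDOp L a m2 K (L ^ K) M μ)) _ hm1
      (fun lam x' => continuousAt_idef_kingDOp_mass M L hL1 ha hK n μ lam x') (fun m2 hm2 hcap2 => (HK m2 hm2 hcap2).2.2.2.2.2.2.2.1)
  · refine hasMaj_ofBlocks_of_massLimit (g := unitTorusGeoS L K M Msz) (blockOf (L ^ K) M) (blockOf (L ^ K) M ∘ underPtN L K n M)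
      (fun m2 => idef (pull (underPtN L K n M)) (pull (underPtN L K n M))
        (pull ⇑(Equiv.addRight (unitVec (fine (L ^ n * L ^ K) M) μ)).symm ∘ₗ kingDOp L a m2 (K + n) (L ^ n * L ^ K) M μ)
        (pull ⇑(Equiv.addRight (unitVec (fine (L ^ K) M) μ)).symm ∘ₗ kingDOp L a m2 K (L ^ K) M μ)) _ hm1 (fun lam x' => ?_)
      (fun m2 hm2 hcap2 => (HK m2 hm2 hcap2).2.2.2.2.2.2.2.2)
    simp only [idef_apply, LinearMap.comp_apply, pull_apply, Pi.sub_apply]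
    exact (continuousAt_kingDOp_mass M (L ^ n * L ^ K) L hL1 ha hKn μ _ _).sub (continuousAt_kingDOp_mass M (L ^ K) L hL1 ha hK μ lam _)

end Letters

/-! ## §2 ★★ The curved knit with a generator FIELD on the closed mass range -/

section Field

variable [NeZero L]

/-- ★★ **dag-n15-w2's Ω-f §1 ON THE CLOSED MASS RANGE `0 ≤ m² ≤ m₀²`** (statement VERBATIM otherwise; proof = dag-n15-e's Ω-c ∕ dag-n15-w2's Ω-f reading of the nine scalar letters
through `tensorId` ∕ `castT` ∕ `covPieces_flat_*` ∕ `idef_conj_eq` — adapted from `…KingModelCurvedKnitField` §1 (itself `…KingModelCurvedKnitFlat` with a field), with §1's closed-range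
letters in place of Ω-b's): for odd `L ≥ 3`, `a > 0`, `m₀² ≥ 0`, `0 < γ < 1`, `0 < α < 1` there are `β, δ, m > 0` such that for every `K ≥ 1`, cube `2L^e`, mass `0 ≤ m² ≤ m₀²`, `Msz`,
every coordinate system `e : 𝔄 ≃ ℝ^ι` and every generator FIELD `Z′` with `‖Z′‖ ≤ r ≤ 1`, `‖Z′_μ(y′) − Z′_μ(y′ − e_ν)‖ ≤ η′g`, second differences `≤ η′G₂`, SKEW coordinate matrices,
under dag-n15-w3's Neumann smallness at `R_V(r, 0, g)`: the η-defect of the curved dressed pairs of King's full `A = 0` propagator `⊗ 1` — dressed by `e^{η′Z′}` on the fine torus, by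
`e^{ηZ̄′}` (block mean) on the coarse one, FLAT base point `W′ = 0` — carries p595387's majorant. [cite: Balaban1985BackgroundPropagators, (3.35)–(3.37) p.396, Thm 3.1 (3.42)–(3.43) pp.397–398, (3.52)–(3.53) p.400, (3.63)–(3.65) pp.402–403 (shapes, mechanism); King1986, (2.13)–(2.17) p.653, (4.1)–(4.5) p.670, p.664 (pairing); Balaban1984PropagatorsI, p.25 (massless `G′`)] -/
theorem hasMaj_idef_curvDressed_kingTorus_king_field_massRange (hLodd : Odd L) (hL : 2 ≤ L) {a : ℝ} (ha : 0 < a) {m0sq : ℝ} (hm0 : 0 ≤ m0sq) {γ : ℝ} (hγ0 : 0 < γ)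
    (hγ1 : γ < 1) {α : ℝ} (hα0 : 0 < α) (hα1 : α < 1) :
    ∃ β δ m : ℝ, 0 < β ∧ 0 < δ ∧ 0 < m ∧ ∀ (K : ℕ), 1 ≤ K → ∀ (e : ℕ) (M : Fin (d + 1) → ℕ) [∀ μ, NeZero (M μ)], (∀ μ, M μ = 2 * L ^ e) →
      ∀ (msq : ℝ), 0 ≤ msq → msq ≤ m0sq → ∀ (Msz : ℝ)
      (ι : Type) [Fintype ι] [DecidableEq ι] (𝔄 : Type) [NormedRing 𝔄] [NormedAlgebra ℝ 𝔄] [CompleteSpace 𝔄] (eB : 𝔄 ≃L[ℝ] (ι → ℝ))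
      (Z' : Fin (d + 1) → Tor (fine L (fine (L ^ K) M)) → (𝔄 →L[ℝ] 𝔄)) (r g G₂ : ℝ), 0 ≤ r → r ≤ 1 → 0 ≤ g → 0 ≤ G₂ → (∀ μ y', ‖Z' μ y'‖ ≤ r) →
      (∀ μ ν y', ‖Z' μ y' - Z' μ (y' - unitVec (fine L (fine (L ^ K) M)) ν)‖ ≤ ((L : ℝ) ^ (K + 1))⁻¹ * g) →
      (∀ μ ν (z' : Tor (fine L (fine (L ^ K) M))), ‖(((L : ℝ) ^ (K + 1))⁻¹)⁻¹ • (Z' μ (z' + unitVec (fine L (fine (L ^ K) M)) ν + unitVec (fine L (fine (L ^ K) M)) μ) -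
          Z' μ (z' + unitVec (fine L (fine (L ^ K) M)) ν)) - (((L : ℝ) ^ (K + 1))⁻¹)⁻¹ • (Z' μ (z' + unitVec (fine L (fine (L ^ K) M)) μ) - Z' μ z')‖ ≤ ((L : ℝ) ^ (K + 1))⁻¹ * G₂) →
      (∀ μ y', (coordMat eB (Z' μ y'))ᵀ = -coordMat eB (Z' μ y')) →
      β * (expRowLetter ι (Fin (d + 1)) (basisConst eB) r 0 g * (1 + Fintype.card (Fin (d + 1) ⊕ Fin (d + 1)))) * B4Sect5Proof.latticeConst (d + 1) (δ / 2) < 1 →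
    HasMaj (BlockNorm.ofBlocks (unitTorusGeoS L K M Msz) (liftBlk (blockOf (L ^ K) M) ι)) (BlockNorm.ofBlocks (unitTorusGeoS L K M Msz) (blkPair (liftBlk (blockOf (L ^ K) M ∘ blockOf L (fine (L ^ K) M)) ι)))
      (idef (pull (liftMap (blockOf L (fine (L ^ K) M)) ι)) (pull (liftPair (liftMap (blockOf L (fine (L ^ K) M)) ι)))
        (curvDressed ((L : ℝ) ^ (K + 1))⁻¹ (torStep (fine L (fine (L ^ K) M))) (expTrField eB ((L : ℝ) ^ (K + 1))⁻¹ 0) (expTrField eB ((L : ℝ) ^ (K + 1))⁻¹ Z') (kingGT₁ L a msq K M ι))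
        (curvDressed ((L : ℝ) * ((L : ℝ) ^ (K + 1))⁻¹) (torStep (fine (L ^ K) M)) (expTrField eB ((L : ℝ) * ((L : ℝ) ^ (K + 1))⁻¹) (blockMeanField L (fine (L ^ K) M) 0)) (expTrField eB ((L : ℝ) * ((L : ℝ) ^ (K + 1))⁻¹) (blockMeanField L (fine (L ^ K) M) Z')) (kingGT L a msq K M ι)))
      (fun y y' => (m * (((L : ℝ) ^ K) ^ (-(γ / 2)) + ((L : ℝ) ^ K) ^ (-α)) * B4Sect5Proof.latticeConst (d + 1) (δ / 2) + 1 * (m * (((L : ℝ) ^ K) ^ (-(γ / 2)) + ((L : ℝ) ^ K) ^ (-α)) * B4Sect5Proof.latticeConst (d + 1) (δ / 2)) * (expRowLetter ι (Fin (d + 1)) (basisConst eB) r 0 g * (1 + Fintype.card (Fin (d + 1) ⊕ Fin (d + 1))) *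
          (β * (1 - β * (expRowLetter ι (Fin (d + 1)) (basisConst eB) r 0 g * (1 + Fintype.card (Fin (d + 1) ⊕ Fin (d + 1)))) * B4Sect5Proof.latticeConst (d + 1) (δ / 2))⁻¹)) +
          β * (expFitLetter ι (Fin (d + 1)) (basisConst eB) r 0 g (((d + 1 : ℕ) : ℝ) * ((L : ℝ) * ((L : ℝ) ^ (K + 1))⁻¹) * g) (((d + 1 : ℕ) : ℝ) * ((L : ℝ) * ((L : ℝ) ^ (K + 1))⁻¹) * g + (L : ℝ) * ((L : ℝ) ^ (K + 1))⁻¹ * g)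
              (((d + 1 : ℕ) : ℝ) * ((L : ℝ) * ((L : ℝ) ^ (K + 1))⁻¹) * 0 + (L : ℝ) * ((L : ℝ) ^ (K + 1))⁻¹ * 0) ((((d + 1 : ℕ) : ℝ) + 1) * ((L : ℝ) * ((L : ℝ) ^ (K + 1))⁻¹) * G₂) ((L : ℝ) * ((L : ℝ) ^ (K + 1))⁻¹) * (1 + Fintype.card (Fin (d + 1) ⊕ Fin (d + 1)))) *
            (β * (1 - β * (expRowLetter ι (Fin (d + 1)) (basisConst eB) r 0 g * (1 + Fintype.card (Fin (d + 1) ⊕ Fin (d + 1)))) * B4Sect5Proof.latticeConst (d + 1) (δ / 2))⁻¹) * B4Sect5Proof.latticeConst (d + 1) (δ / 2)) *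
        (1 - 1 * (β * (expRowLetter ι (Fin (d + 1)) (basisConst eB) r 0 g * (1 + Fintype.card (Fin (d + 1) ⊕ Fin (d + 1)))) * B4Sect5Proof.latticeConst (d + 1) (δ / 2)))⁻¹ * Real.exp (-(δ / 2 * tdistT M y y'))) := by
  obtain ⟨β, δ, m, hβ, hδ, hm, H⟩ := kingFullProp_layer_backward_massRange (d := d) L hLodd hL ha hm0 hγ0.le hγ1 hα0 hα1
  refine ⟨β, δ, m, hβ, hδ, hm, fun K hK e M _ hM msq hmsq hcap Msz ι _ _ 𝔄 _ _ _ eB Z' r g G₂ hr0 hr1 hg hG₂ hZ' hgrad' hsec' hZs' hq => ?_⟩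
  have hL1 : (1 : ℝ) ≤ (L : ℝ) := by exact_mod_cast (show 1 ≤ L by omega)
  have hL0 : (0 : ℝ) < (L : ℝ) := by positivity
  have hη' : 0 < ((L : ℝ) ^ (K + 1))⁻¹ := by positivity
  have hθ0 : 0 ≤ ((L : ℝ) ^ K) ^ (-(γ / 2)) + ((L : ℝ) ^ K) ^ (-α) :=
    add_nonneg (Real.rpow_nonneg (pow_nonneg hL0.le _) _) (Real.rpow_nonneg (pow_nonneg hL0.le _) _)
  have hmθ : 0 ≤ m * (((L : ℝ) ^ K) ^ (-(γ / 2)) + ((L : ℝ) ^ K) ^ (-α)) := mul_nonneg hm.le hθ0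
  have hηη₀ : (L : ℝ) * ((L : ℝ) ^ (K + 1))⁻¹ ≤ 1 := by
    rw [pow_succ', mul_inv, ← mul_assoc, mul_inv_cancel₀ hL0.ne', one_mul]
    exact inv_le_one_of_one_le₀ (one_le_pow₀ hL1)
  -- the carrier facts
  have hσ : 0 < δ / 2 := half_pos hδ
  have htri : Triangle254 (unitTorusGeoS L K M Msz) := triangle254_unitTorusGeo L K M
  have hd : ∀ a b : (unitTorusGeoS L K M Msz).Site, 0 ≤ (unitTorusGeoS L K M Msz).dist a b := fun a b => tdistT_nonneg M a b
  have hrow : RowSum (unitTorusGeoS L K M Msz) (δ / 2) (B4Sect5Proof.latticeConst (d + 1) (δ / 2)) := rowSum_unitTorusGeo L K M hσ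
  have hcr : 0 ≤ B4Sect5Proof.latticeConst (d + 1) (δ / 2) := B4Sect5Proof.latticeConst_nonneg (d + 1) hσ.le
  -- the nine scalar letters one level up (`n = 1`), their majorants nonnegative
  have HK := fun μ : Fin (d + 1) => H K hK 1 le_rfl e M hM msq hmsq hcap Msz μ
  have maj0 : ∀ y y' : Tor M, 0 ≤ β * Real.exp (-(δ * tdistT M y y')) := fun _ _ => by positivity
  have majm : ∀ y y' : Tor M, 0 ≤ m * (((L : ℝ) ^ K) ^ (-(γ / 2)) + ((L : ℝ) ^ K) ^ (-α)) * Real.exp (-(δ * tdistT M y y')) :=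
    fun _ _ => mul_nonneg hmθ (Real.exp_nonneg _)
  -- (hG) `G = A₀⁻¹ ⊗ 1`
  have hG : HasMaj (BlockNorm.ofBlocks (unitTorusGeoS L K M Msz) (liftBlk (blockOf (L ^ K) M) ι))
      (BlockNorm.ofBlocks (unitTorusGeoS L K M Msz) (liftBlk (blockOf (L ^ K) M) ι)) (kingGT L a msq K M ι)
      (fun y y' => β * Real.exp (-(δ * (unitTorusGeoS L K M Msz).dist y y'))) :=
    hasMaj_tensorId ι maj0 (HK 0).1
  -- (hD) the coarse covariant pieces at the flat point
  have hD : ∀ j, HasMaj (BlockNorm.ofBlocks (unitTorusGeoS L K M Msz) (liftBlk (blockOf (L ^ K) M) ι))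
      (BlockNorm.ofBlocks (unitTorusGeoS L K M Msz) (liftBlk (blockOf (L ^ K) M) ι))
      (covPieces ((L : ℝ) * ((L : ℝ) ^ (K + 1))⁻¹) (torStep (fine (L ^ K) M))
        (gaugePair (torStep (fine (L ^ K) M)) (expTrField eB ((L : ℝ) * ((L : ℝ) ^ (K + 1))⁻¹)
          (blockMeanField L (fine (L ^ K) M) (0 : Fin (d + 1) → Tor (fine L (fine (L ^ K) M)) → (𝔄 →L[ℝ] 𝔄))))) (kingGT L a msq K M ι) j)
      (fun y y' => β * Real.exp (-(δ * (unitTorusGeoS L K M Msz).dist y y'))) := by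
    intro j
    rw [blockMeanField_zero, expTrField_zero, gaugePair_one]
    cases j with
    | inl μ => rw [covPieces_flat_coarse_inl]; exact hasMaj_tensorId ι maj0 (HK μ).2.1
    | inr μ => rw [covPieces_flat_coarse_inr]; exact hasMaj_tensorId ι maj0 (HK μ).2.2.1
  -- (hG′) `G′ = (cast∘A₀′⁻¹∘cast⁻¹) ⊗ 1`
  have hG' : HasMaj (BlockNorm.ofBlocks (unitTorusGeoS L K M Msz) (liftBlk (blockOf (L ^ K) M ∘ blockOf L (fine (L ^ K) M)) ι))
      (BlockNorm.ofBlocks (unitTorusGeoS L K M Msz) (liftBlk (blockOf (L ^ K) M ∘ blockOf L (fine (L ^ K) M)) ι)) (kingGT₁ L a msq K M ι)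
      (fun y y' => β * Real.exp (-(δ * (unitTorusGeoS L K M Msz).dist y y'))) := by
    refine hasMaj_tensorId ι maj0 ?_
    rw [blockOf_comp_blockOf_eq]
    exact hasMaj_conjEquiv _ _ (castT L K M) maj0 (HK 0).2.2.2.1
  -- (hD′) the fine covariant pieces at the flat point
  have hD' : ∀ j, HasMaj (BlockNorm.ofBlocks (unitTorusGeoS L K M Msz) (liftBlk (blockOf (L ^ K) M ∘ blockOf L (fine (L ^ K) M)) ι))
      (BlockNorm.ofBlocks (unitTorusGeoS L K M Msz) (liftBlk (blockOf (L ^ K) M ∘ blockOf L (fine (L ^ K) M)) ι))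
      (covPieces (((L : ℝ) ^ (K + 1))⁻¹) (torStep (fine L (fine (L ^ K) M)))
        (gaugePair (torStep (fine L (fine (L ^ K) M))) (expTrField eB (((L : ℝ) ^ (K + 1))⁻¹)
          (0 : Fin (d + 1) → Tor (fine L (fine (L ^ K) M)) → (𝔄 →L[ℝ] 𝔄)))) (kingGT₁ L a msq K M ι) j)
      (fun y y' => β * Real.exp (-(δ * (unitTorusGeoS L K M Msz).dist y y'))) := by
    intro j
    rw [expTrField_zero, gaugePair_one]
    cases j with
    | inl μ =>
        rw [covPieces_flat_fine_inl]
        refine hasMaj_tensorId ι maj0 ?_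
        rw [blockOf_comp_blockOf_eq]
        exact hasMaj_conjEquiv _ _ (castT L K M) maj0 (HK μ).2.2.2.2.1
    | inr μ =>
        rw [covPieces_flat_fine_inr]
        refine hasMaj_tensorId ι maj0 ?_
        rw [blockOf_comp_blockOf_eq]
        exact hasMaj_conjEquiv _ _ (castT L K M) maj0 (HK μ).2.2.2.2.2.1
  -- (hDG) the two-grid defect of `G`
  have hDG : HasMaj (BlockNorm.ofBlocks (unitTorusGeoS L K M Msz) (liftBlk (blockOf (L ^ K) M) ι))
      (BlockNorm.ofBlocks (unitTorusGeoS L K M Msz) (liftBlk (blockOf (L ^ K) M ∘ blockOf L (fine (L ^ K) M)) ι))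
      (idef (pull (liftMap (blockOf L (fine (L ^ K) M)) ι)) (pull (liftMap (blockOf L (fine (L ^ K) M)) ι)) (kingGT₁ L a msq K M ι) (kingGT L a msq K M ι))
      (fun y y' => m * (((L : ℝ) ^ K) ^ (-(γ / 2)) + ((L : ℝ) ^ K) ^ (-α)) * Real.exp (-(δ * (unitTorusGeoS L K M Msz).dist y y'))) := by
    rw [kingGT₁, kingGT, idef_tensorId]
    refine hasMaj_tensorId ι majm ?_
    rw [kingGOp₁, idef_conj_eq, blockOf_comp_blockOf_eq]
    exact hasMaj_pullEquiv_comp _ (castT L K M) majm (HK 0).2.2.2.2.2.2.1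
  -- (hDD) the two-grid defects of the covariant pieces
  have hDD : ∀ j, HasMaj (BlockNorm.ofBlocks (unitTorusGeoS L K M Msz) (liftBlk (blockOf (L ^ K) M) ι))
      (BlockNorm.ofBlocks (unitTorusGeoS L K M Msz) (liftBlk (blockOf (L ^ K) M ∘ blockOf L (fine (L ^ K) M)) ι))
      (idef (pull (liftMap (blockOf L (fine (L ^ K) M)) ι)) (pull (liftMap (blockOf L (fine (L ^ K) M)) ι))
        (covPieces (((L : ℝ) ^ (K + 1))⁻¹) (torStep (fine L (fine (L ^ K) M)))
          (gaugePair (torStep (fine L (fine (L ^ K) M))) (expTrField eB (((L : ℝ) ^ (K + 1))⁻¹)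
            (0 : Fin (d + 1) → Tor (fine L (fine (L ^ K) M)) → (𝔄 →L[ℝ] 𝔄)))) (kingGT₁ L a msq K M ι) j)
        (covPieces ((L : ℝ) * ((L : ℝ) ^ (K + 1))⁻¹) (torStep (fine (L ^ K) M))
          (gaugePair (torStep (fine (L ^ K) M)) (expTrField eB ((L : ℝ) * ((L : ℝ) ^ (K + 1))⁻¹)
            (blockMeanField L (fine (L ^ K) M) (0 : Fin (d + 1) → Tor (fine L (fine (L ^ K) M)) → (𝔄 →L[ℝ] 𝔄))))) (kingGT L a msq K M ι) j))
      (fun y y' => m * (((L : ℝ) ^ K) ^ (-(γ / 2)) + ((L : ℝ) ^ K) ^ (-α)) * Real.exp (-(δ * (unitTorusGeoS L K M Msz).dist y y'))) := by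
    intro j
    rw [blockMeanField_zero, expTrField_zero, expTrField_zero, gaugePair_one, gaugePair_one]
    cases j with
    | inl μ =>
        rw [covPieces_flat_fine_inl, covPieces_flat_coarse_inl, idef_tensorId]
        refine hasMaj_tensorId ι majm ?_
        rw [idef_conj_eq, blockOf_comp_blockOf_eq]
        exact hasMaj_pullEquiv_comp _ (castT L K M) majm (HK μ).2.2.2.2.2.2.2.1
    | inr μ =>
        rw [covPieces_flat_fine_inr, covPieces_flat_coarse_inr, idef_tensorId]
        refine hasMaj_tensorId ι majm ?_
        rw [idef_conj_eq, blockOf_comp_blockOf_eq]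
        exact hasMaj_pullEquiv_comp _ (castT L K M) majm (HK μ).2.2.2.2.2.2.2.2
  -- the knit
  exact hasMaj_idef_curvDressed_kingTorus L (fine (L ^ K) M) eB (blockOf (L ^ K) M) (((L : ℝ) ^ (K + 1))⁻¹) Z' 0
    (kingGT L a msq K M ι) (kingGT₁ L a msq K M ι) (geo := unitTorusGeoS L K M Msz) (σ := δ / 2) (cr := B4Sect5Proof.latticeConst (d + 1) (δ / 2))
    (ρ := δ / 2) (δ := δ) (β := β) (m := m * (((L : ℝ) ^ K) ^ (-(γ / 2)) + ((L : ℝ) ^ K) ^ (-α))) (η₀ := 1) (r := r) (rB := 0) (g := g) (gB := 0) (G₂ := G₂)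
    htri hd hσ.le hcr hrow hσ.le (by linarith) hβ.le hmθ (by rw [one_mul]; exact hr1) (by norm_num) hη' hηη₀ hr0 le_rfl hg le_rfl hG₂
    hG hD hG' hD' hDG hDD hZ' (fun _ _ => by simp) hgrad' (fun _ _ _ => by simp) hsec'
    hZs' (fun _ _ => by
      have h0 := coordMat_sub eB (0 : 𝔄 →L[ℝ] 𝔄) 0
      rw [sub_self, sub_self] at h0
      rw [Pi.zero_apply, Pi.zero_apply, h0, Matrix.transpose_zero, neg_zero]) hq

end Field

/-! ## §3 ★★ The `𝔲(N)` edition on the closed mass range: King's propagator `⊗ 1` dressed by `Ad(e^{η′A′(x)})`, letters on the potential -/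

section Adjoint

variable [NeZero L]
variable {n : Type} [Fintype n] [DecidableEq n] {κ : Type} [Fintype κ] [DecidableEq κ] (e : Matrix n n ℂ ≃L[ℝ] (κ → ℝ))

/-- ★★ **dag-n15-w2's Ω-f §2 ON THE CLOSED MASS RANGE**: §2 at `𝔄 = M_N(ℂ)` (Frobenius ∕ trace-form norm), `ι = κ`, `e` trace-form-orthonormal (`he`), `Z′ = ad ∘ A′` for a
skew-Hermitian lattice gauge field `A′` on the fine torus with the (3.35)∕(3.36)-SHAPED letters ON THE POTENTIAL `‖A′_μ(y′)‖ ≤ a₀` (`2a₀ ≤ 1`), `‖A′_μ(y′) − A′_μ(y′ − e_ν)‖ ≤ η′g_A`,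
second differences `≤ η′G_A` (generator letters `2a₀, 2g_A, 2G_A` by `‖ad_X‖ ≤ 2‖X‖`; skewness by p595427), masses `0 ≤ m² ≤ m₀²` — the transporter `e^{η′ ad A′(x)} = Ad(e^{η′A′(x)})`
(p596957) is the GENUINE adjoint transporter of the bond variable `e^{η′A′(x)} ∈ U(N)` (proof = Ω-f §2's wrapper verbatim). [cite: Balaban1985BackgroundPropagators, (3.35)–(3.37) p.396, (3.50) p.400 (adjoint transporter: shapes), (3.63)–(3.65) pp.402–403 (mechanism); King1986, (4.1)–(4.5) p.670; Balaban1984PropagatorsI, p.25] -/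
theorem uN_hasMaj_idef_curvDressed_kingTorus_king_field_massRange (he : ∀ X Y : Matrix n n ℂ, traceForm X Y = e X ⬝ᵥ e Y) (hLodd : Odd L) (hL : 2 ≤ L) {a : ℝ} (ha : 0 < a)
    {m0sq : ℝ} (hm0 : 0 ≤ m0sq) {γ : ℝ} (hγ0 : 0 < γ) (hγ1 : γ < 1) {α : ℝ} (hα0 : 0 < α) (hα1 : α < 1) :
    ∃ β δ m : ℝ, 0 < β ∧ 0 < δ ∧ 0 < m ∧ ∀ (K : ℕ), 1 ≤ K → ∀ (ex : ℕ) (M : Fin (d + 1) → ℕ) [∀ μ, NeZero (M μ)], (∀ μ, M μ = 2 * L ^ ex) →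
      ∀ (msq : ℝ), 0 ≤ msq → msq ≤ m0sq → ∀ (Msz : ℝ) (A' : Fin (d + 1) → Tor (fine L (fine (L ^ K) M)) → Matrix n n ℂ) (a₀ gA GA : ℝ),
      0 ≤ a₀ → 2 * a₀ ≤ 1 → 0 ≤ gA → 0 ≤ GA → (∀ μ y', ‖A' μ y'‖ ≤ a₀) →
      (∀ μ ν y', ‖A' μ y' - A' μ (y' - unitVec (fine L (fine (L ^ K) M)) ν)‖ ≤ ((L : ℝ) ^ (K + 1))⁻¹ * gA) →
      (∀ μ ν (z' : Tor (fine L (fine (L ^ K) M))), ‖(((L : ℝ) ^ (K + 1))⁻¹)⁻¹ • (A' μ (z' + unitVec (fine L (fine (L ^ K) M)) ν + unitVec (fine L (fine (L ^ K) M)) μ) -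
          A' μ (z' + unitVec (fine L (fine (L ^ K) M)) ν)) - (((L : ℝ) ^ (K + 1))⁻¹)⁻¹ • (A' μ (z' + unitVec (fine L (fine (L ^ K) M)) μ) - A' μ z')‖ ≤ ((L : ℝ) ^ (K + 1))⁻¹ * GA) →
      (∀ μ y', (A' μ y')ᴴ = -A' μ y') →
      β * (expRowLetter κ (Fin (d + 1)) (basisConst e) (2 * a₀) 0 (2 * gA) * (1 + Fintype.card (Fin (d + 1) ⊕ Fin (d + 1)))) * B4Sect5Proof.latticeConst (d + 1) (δ / 2) < 1 →
    HasMaj (BlockNorm.ofBlocks (unitTorusGeoS L K M Msz) (liftBlk (blockOf (L ^ K) M) κ)) (BlockNorm.ofBlocks (unitTorusGeoS L K M Msz) (blkPair (liftBlk (blockOf (L ^ K) M ∘ blockOf L (fine (L ^ K) M)) κ)))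
      (idef (pull (liftMap (blockOf L (fine (L ^ K) M)) κ)) (pull (liftPair (liftMap (blockOf L (fine (L ^ K) M)) κ)))
        (curvDressed ((L : ℝ) ^ (K + 1))⁻¹ (torStep (fine L (fine (L ^ K) M))) (expTrField e ((L : ℝ) ^ (K + 1))⁻¹ 0) (expTrField e ((L : ℝ) ^ (K + 1))⁻¹ (fun μ y' => adCLM ℝ (A' μ y'))) (kingGT₁ L a msq K M κ))
        (curvDressed ((L : ℝ) * ((L : ℝ) ^ (K + 1))⁻¹) (torStep (fine (L ^ K) M)) (expTrField e ((L : ℝ) * ((L : ℝ) ^ (K + 1))⁻¹) (blockMeanField L (fine (L ^ K) M) 0)) (expTrField e ((L : ℝ) * ((L : ℝ) ^ (K + 1))⁻¹) (blockMeanField L (fine (L ^ K) M) (fun μ y' => adCLM ℝ (A' μ y')))) (kingGT L a msq K M κ)))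
      (fun y y' => (m * (((L : ℝ) ^ K) ^ (-(γ / 2)) + ((L : ℝ) ^ K) ^ (-α)) * B4Sect5Proof.latticeConst (d + 1) (δ / 2) + 1 * (m * (((L : ℝ) ^ K) ^ (-(γ / 2)) + ((L : ℝ) ^ K) ^ (-α)) * B4Sect5Proof.latticeConst (d + 1) (δ / 2)) * (expRowLetter κ (Fin (d + 1)) (basisConst e) (2 * a₀) 0 (2 * gA) * (1 + Fintype.card (Fin (d + 1) ⊕ Fin (d + 1))) *
          (β * (1 - β * (expRowLetter κ (Fin (d + 1)) (basisConst e) (2 * a₀) 0 (2 * gA) * (1 + Fintype.card (Fin (d + 1) ⊕ Fin (d + 1)))) * B4Sect5Proof.latticeConst (d + 1) (δ / 2))⁻¹)) +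
          β * (expFitLetter κ (Fin (d + 1)) (basisConst e) (2 * a₀) 0 (2 * gA) (((d + 1 : ℕ) : ℝ) * ((L : ℝ) * ((L : ℝ) ^ (K + 1))⁻¹) * (2 * gA)) (((d + 1 : ℕ) : ℝ) * ((L : ℝ) * ((L : ℝ) ^ (K + 1))⁻¹) * (2 * gA) + (L : ℝ) * ((L : ℝ) ^ (K + 1))⁻¹ * (2 * gA))
              (((d + 1 : ℕ) : ℝ) * ((L : ℝ) * ((L : ℝ) ^ (K + 1))⁻¹) * 0 + (L : ℝ) * ((L : ℝ) ^ (K + 1))⁻¹ * 0) ((((d + 1 : ℕ) : ℝ) + 1) * ((L : ℝ) * ((L : ℝ) ^ (K + 1))⁻¹) * (2 * GA)) ((L : ℝ) * ((L : ℝ) ^ (K + 1))⁻¹) * (1 + Fintype.card (Fin (d + 1) ⊕ Fin (d + 1)))) *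
            (β * (1 - β * (expRowLetter κ (Fin (d + 1)) (basisConst e) (2 * a₀) 0 (2 * gA) * (1 + Fintype.card (Fin (d + 1) ⊕ Fin (d + 1)))) * B4Sect5Proof.latticeConst (d + 1) (δ / 2))⁻¹) * B4Sect5Proof.latticeConst (d + 1) (δ / 2)) *
        (1 - 1 * (β * (expRowLetter κ (Fin (d + 1)) (basisConst e) (2 * a₀) 0 (2 * gA) * (1 + Fintype.card (Fin (d + 1) ⊕ Fin (d + 1)))) * B4Sect5Proof.latticeConst (d + 1) (δ / 2)))⁻¹ * Real.exp (-(δ / 2 * tdistT M y y'))) := by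
  obtain ⟨β, δ, m, hβ, hδ, hm, H⟩ := hasMaj_idef_curvDressed_kingTorus_king_field_massRange (d := d) L hLodd hL ha hm0 hγ0 hγ1 hα0 hα1
  refine ⟨β, δ, m, hβ, hδ, hm, fun K hK ex M _ hM msq hmsq hcap Msz A' a₀ gA GA ha0 ha1 hgA hGA hA hgradA hsecA hAs hq => ?_⟩
  -- the generator-level letters READ OFF the potential's letters through `‖ad_X‖ ≤ 2‖X‖` and the linearity of `ad`; skewness from file 3
  have h2 : ∀ {X : Matrix n n ℂ} {c : ℝ}, ‖X‖ ≤ c → ‖adCLM ℝ X‖ ≤ 2 * c := fun hX => (norm_adCLM_le ℝ _).trans (mul_le_mul_of_nonneg_left hX two_pos.le)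
  have hZ' : ∀ μ y', ‖adCLM ℝ (A' μ y')‖ ≤ 2 * a₀ := fun μ y' => h2 (hA μ y')
  have hgrad' : ∀ μ ν y', ‖adCLM ℝ (A' μ y') - adCLM ℝ (A' μ (y' - unitVec (fine L (fine (L ^ K) M)) ν))‖ ≤ ((L : ℝ) ^ (K + 1))⁻¹ * (2 * gA) := fun μ ν y' => by
    rw [adCLM_sub, mul_left_comm]; exact h2 (hgradA μ ν y')
  have hsec' : ∀ μ ν (z' : Tor (fine L (fine (L ^ K) M))), ‖(((L : ℝ) ^ (K + 1))⁻¹)⁻¹ • (adCLM ℝ (A' μ (z' + unitVec (fine L (fine (L ^ K) M)) ν + unitVec (fine L (fine (L ^ K) M)) μ)) -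
      adCLM ℝ (A' μ (z' + unitVec (fine L (fine (L ^ K) M)) ν))) - (((L : ℝ) ^ (K + 1))⁻¹)⁻¹ • (adCLM ℝ (A' μ (z' + unitVec (fine L (fine (L ^ K) M)) μ)) - adCLM ℝ (A' μ z'))‖ ≤
      ((L : ℝ) ^ (K + 1))⁻¹ * (2 * GA) := fun μ ν z' => by
    rw [adCLM_sub, adCLM_sub, ← adCLM_smul, ← adCLM_smul, adCLM_sub, mul_left_comm]; exact h2 (hsecA μ ν z')
  have hZs' : ∀ μ y', (coordMat e (adCLM ℝ (A' μ y')))ᵀ = -coordMat e (adCLM ℝ (A' μ y')) := fun μ y' =>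
    coordMat_adCLM_transpose_eq_neg_of_conjTranspose e he (hAs μ y')
  exact H K hK ex M hM msq hmsq hcap Msz κ (Matrix n n ℂ) e (fun μ y' => adCLM ℝ (A' μ y')) (2 * a₀) (2 * gA) (2 * GA) (by positivity) ha1 (by positivity) (by positivity)
    hZ' hgrad' hsec' hZs' hq

/-- The `m² = 0` member of §3: the MASSLESS coloured site propagator `⊗ 1` dressed by `Ad(e^{η′A′(x)})` for a small, slowly varying skew-Hermitian `A′` — two-grid η-defect at ONE `(β, δ, m)`.
[cite: Balaban1985BackgroundPropagators, (3.50) p.400, (3.63)–(3.65) pp.402–403; Balaban1984PropagatorsI, p.25] -/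
theorem uN_hasMaj_idef_curvDressed_kingTorus_king_field_massless (he : ∀ X Y : Matrix n n ℂ, traceForm X Y = e X ⬝ᵥ e Y) (hLodd : Odd L) (hL : 2 ≤ L) {a : ℝ} (ha : 0 < a)
    {γ : ℝ} (hγ0 : 0 < γ) (hγ1 : γ < 1) {α : ℝ} (hα0 : 0 < α) (hα1 : α < 1) :
    ∃ β δ m : ℝ, 0 < β ∧ 0 < δ ∧ 0 < m ∧ ∀ (K : ℕ), 1 ≤ K → ∀ (ex : ℕ) (M : Fin (d + 1) → ℕ) [∀ μ, NeZero (M μ)], (∀ μ, M μ = 2 * L ^ ex) →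
      ∀ (Msz : ℝ) (A' : Fin (d + 1) → Tor (fine L (fine (L ^ K) M)) → Matrix n n ℂ) (a₀ gA GA : ℝ),
      0 ≤ a₀ → 2 * a₀ ≤ 1 → 0 ≤ gA → 0 ≤ GA → (∀ μ y', ‖A' μ y'‖ ≤ a₀) →
      (∀ μ ν y', ‖A' μ y' - A' μ (y' - unitVec (fine L (fine (L ^ K) M)) ν)‖ ≤ ((L : ℝ) ^ (K + 1))⁻¹ * gA) →
      (∀ μ ν (z' : Tor (fine L (fine (L ^ K) M))), ‖(((L : ℝ) ^ (K + 1))⁻¹)⁻¹ • (A' μ (z' + unitVec (fine L (fine (L ^ K) M)) ν + unitVec (fine L (fine (L ^ K) M)) μ) -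
          A' μ (z' + unitVec (fine L (fine (L ^ K) M)) ν)) - (((L : ℝ) ^ (K + 1))⁻¹)⁻¹ • (A' μ (z' + unitVec (fine L (fine (L ^ K) M)) μ) - A' μ z')‖ ≤ ((L : ℝ) ^ (K + 1))⁻¹ * GA) →
      (∀ μ y', (A' μ y')ᴴ = -A' μ y') →
      β * (expRowLetter κ (Fin (d + 1)) (basisConst e) (2 * a₀) 0 (2 * gA) * (1 + Fintype.card (Fin (d + 1) ⊕ Fin (d + 1)))) * B4Sect5Proof.latticeConst (d + 1) (δ / 2) < 1 →
    HasMaj (BlockNorm.ofBlocks (unitTorusGeoS L K M Msz) (liftBlk (blockOf (L ^ K) M) κ)) (BlockNorm.ofBlocks (unitTorusGeoS L K M Msz) (blkPair (liftBlk (blockOf (L ^ K) M ∘ blockOf L (fine (L ^ K) M)) κ)))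
      (idef (pull (liftMap (blockOf L (fine (L ^ K) M)) κ)) (pull (liftPair (liftMap (blockOf L (fine (L ^ K) M)) κ)))
        (curvDressed ((L : ℝ) ^ (K + 1))⁻¹ (torStep (fine L (fine (L ^ K) M))) (expTrField e ((L : ℝ) ^ (K + 1))⁻¹ 0) (expTrField e ((L : ℝ) ^ (K + 1))⁻¹ (fun μ y' => adCLM ℝ (A' μ y'))) (kingGT₁ L a 0 K M κ))
        (curvDressed ((L : ℝ) * ((L : ℝ) ^ (K + 1))⁻¹) (torStep (fine (L ^ K) M)) (expTrField e ((L : ℝ) * ((L : ℝ) ^ (K + 1))⁻¹) (blockMeanField L (fine (L ^ K) M) 0)) (expTrField e ((L : ℝ) * ((L : ℝ) ^ (K + 1))⁻¹) (blockMeanField L (fine (L ^ K) M) (fun μ y' => adCLM ℝ (A' μ y')))) (kingGT L a 0 K M κ)))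
      (fun y y' => (m * (((L : ℝ) ^ K) ^ (-(γ / 2)) + ((L : ℝ) ^ K) ^ (-α)) * B4Sect5Proof.latticeConst (d + 1) (δ / 2) + 1 * (m * (((L : ℝ) ^ K) ^ (-(γ / 2)) + ((L : ℝ) ^ K) ^ (-α)) * B4Sect5Proof.latticeConst (d + 1) (δ / 2)) * (expRowLetter κ (Fin (d + 1)) (basisConst e) (2 * a₀) 0 (2 * gA) * (1 + Fintype.card (Fin (d + 1) ⊕ Fin (d + 1))) *
          (β * (1 - β * (expRowLetter κ (Fin (d + 1)) (basisConst e) (2 * a₀) 0 (2 * gA) * (1 + Fintype.card (Fin (d + 1) ⊕ Fin (d + 1)))) * B4Sect5Proof.latticeConst (d + 1) (δ / 2))⁻¹)) +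
          β * (expFitLetter κ (Fin (d + 1)) (basisConst e) (2 * a₀) 0 (2 * gA) (((d + 1 : ℕ) : ℝ) * ((L : ℝ) * ((L : ℝ) ^ (K + 1))⁻¹) * (2 * gA)) (((d + 1 : ℕ) : ℝ) * ((L : ℝ) * ((L : ℝ) ^ (K + 1))⁻¹) * (2 * gA) + (L : ℝ) * ((L : ℝ) ^ (K + 1))⁻¹ * (2 * gA))
              (((d + 1 : ℕ) : ℝ) * ((L : ℝ) * ((L : ℝ) ^ (K + 1))⁻¹) * 0 + (L : ℝ) * ((L : ℝ) ^ (K + 1))⁻¹ * 0) ((((d + 1 : ℕ) : ℝ) + 1) * ((L : ℝ) * ((L : ℝ) ^ (K + 1))⁻¹) * (2 * GA)) ((L : ℝ) * ((L : ℝ) ^ (K + 1))⁻¹) * (1 + Fintype.card (Fin (d + 1) ⊕ Fin (d + 1)))) *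
            (β * (1 - β * (expRowLetter κ (Fin (d + 1)) (basisConst e) (2 * a₀) 0 (2 * gA) * (1 + Fintype.card (Fin (d + 1) ⊕ Fin (d + 1)))) * B4Sect5Proof.latticeConst (d + 1) (δ / 2))⁻¹) * B4Sect5Proof.latticeConst (d + 1) (δ / 2)) *
        (1 - 1 * (β * (expRowLetter κ (Fin (d + 1)) (basisConst e) (2 * a₀) 0 (2 * gA) * (1 + Fintype.card (Fin (d + 1) ⊕ Fin (d + 1)))) * B4Sect5Proof.latticeConst (d + 1) (δ / 2)))⁻¹ * Real.exp (-(δ / 2 * tdistT M y y'))) := by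
  obtain ⟨β, δ, m, hβ, hδ, hm, H⟩ := uN_hasMaj_idef_curvDressed_kingTorus_king_field_massRange (d := d) L e he hLodd hL ha le_rfl hγ0 hγ1 hα0 hα1
  exact ⟨β, δ, m, hβ, hδ, hm, fun K hK ex M _ hM Msz A' a₀ gA GA => H K hK ex M hM 0 le_rfl le_rfl Msz A' a₀ gA GA⟩

end Adjoint

end Summit.QuantumFields.YangMills.BalabanUVNodes.N15.SiteLayerBg

end
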